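import Literature.MathematicalPhysics.QuantumFieldTheory.Balaban1983to89.B6LeafB6OneLevelFamG

/-!
# NODE 00 (YM-PLAN Track A) — the B6 group (`D6 : B6.BlockData`) of the carrier bundle `X : DagBinding.PrintedCarriersR` AT THE CONCRETE
# ONE-LEVEL KNIT BLOCK of the lit-balaban r03 lineage ([Balaban1984PropagatorsII] Lemma 2.1 – Cor. 2.8), and what it gives the DAG node N03
# (`Dag.B6_main`)

NODE 00 STAGE-1 MODULE (seat `pub-ymgap-node00-def`, YM-PLAN §2a NODE 00; root module of record `Node00Carriers`, whose CONVENTIONS OF RECORD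
block applies here), NOT by itself a discharge booking (node rows are booked by the plan seat and the leads).  HONEST FRAMING: definitions + kernel bookkeeping; the analytic content is the lit-balaban r02∕r03∕p01∕b05∕b06 lineages' —
`B6LeafB6OneLevelFamG.b6BlockParam_oneLevel_famG` (r03 gen 14: the whole leaf `DagBinding.B6BlockParam` on the one-level knit block `knitBlockG`
whose Prop. 2.5 carrier is [4]'s genuine torus family) — cited by name.  Nothing of the series' end statement; no continuum ∕ mass-gap claim.

WHAT THIS FILE SHOWS (scoping report NODE00-SCOPING.md §2.5):
* `Node00.withB6 X D` — generic plumbing: `X` with its B6 block data `D6` replaced;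
* `Node00.withB6OfRecord X d L a δ₀ m²` — `D6 := knitBlockG d L a δ₀ (blockGp d L a m²)` (index = B5's top-level tori `TopIdx d L`; geometries
  `blockGeo`; the kernels `G′`, `(Q′G′²Q′*)⁻¹`, `G`, `(QGQ*)⁻¹`, `H` of the block; Lemma 2.4's concrete lattice trees; Prop. 2.5's local operators =
  r02's `latticeSettingP12R` settings via `B6Prop25OneLevelFamG.locG`);
* `b6_withB6OfRecord` — at these carriers the leaf `b6` of the binding of record `Upstream.ofPrintedAllXP` (the PARAMETER-form block
  `DagBinding.B6BlockParam X.D6`) HOLDS outright (`d ≥ 2`, `L` odd `> 1`, `a > 0`, `δ₀ > 0`, `m² ≥ 0`); the same field in the N-binding;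
* `b6_main_withB6OfRecord` — hence `Dag.B6_main (DagBinding.leavesP w P)` (= the venue's `YMDAG.N03 w P`, «b4 → b5 → b6») for EVERY binding world `w`
  whose upstream block is `ofPrintedAllXP (withB6OfRecord X d L a δ₀ m²) Y Z V W`, every run `P` (the antecedents `b4`, `b5` are not used).
LOCATED READINGS inherited from the lineage (for the cross-read ∕ rulings Q-N00-2∕6; NOT adjudicated here): ONE-LEVEL block — the printed geometries
(2.1)–(2.2) are sequences {Ω_j}, {Λ_j} over k scales; on the knit block `Hyp21_22 := True` and `M = 1` (`knitG_meets_hypotheses`), i.e. the family is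
the ONE-LEVEL SUB-FAMILY of the printed instances (report §2.5: the multi-level `BlockData` of record is the open M-sized item); `δ₀` is a carrier
datum; «constants ours» (the module's own words); `d ≥ 2`; `U = 1` as in [B6]; torus.
-/

noncomputable section

namespace Literature.MathematicalPhysics.QuantumFieldTheory.Balaban1983to89.Node00

open DagBinding
open B6LeafB6OneLevelFamG (knitBlockG b6BlockParam_oneLevel_famG)
open B6Prop22BlockFamily (blockGp)

/-- Generic plumbing: the carrier bundle `X` with its B6 block data ([Balaban1984PropagatorsII]) replaced; every other group unchanged. [folklore] -/
def withB6 (X : PrintedCarriersR) (D : B6.BlockData) : PrintedCarriersR :=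
  { X with D6 := D }

/-- **The carrier bundle `X` with its B6 block data set to the CONCRETE one-level knit block** `knitBlockG d L a δ₀ (blockGp d L a m²)` of the
lit-balaban r03 lineage (decay rate `δ₀`, mass `m²` of [2] (1.6) as parameters). [cite: Balaban1984PropagatorsII, (2.1)–(2.2) p.224, Lemma 2.1 – Cor. 2.8 pp.234–249] -/
def withB6OfRecord (X : PrintedCarriersR) (d L : ℕ) (a δ₀ msq : ℝ) : PrintedCarriersR :=
  withB6 X (knitBlockG d L a δ₀ (blockGp d L a msq))

/-- **Leaf `b6` (parameter form) HOLDS at the B6 objects of the lineage** (`d ≥ 2`, `L` odd `> 1`, `a > 0`, `δ₀ > 0`, `m² ≥ 0`):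
`DagBinding.B6BlockParam (knitBlockG …)` is `B6LeafB6OneLevelFamG.b6BlockParam_oneLevel_famG`, by name (the `b6` field of `ofPrintedAllXP` is
`B6BlockParam X.D6`, `DagBinding.ofPrintedAllXP_leaves`). [cite: Balaban1984PropagatorsII, Lemma 2.1 p.234, Prop. 2.2 p.234, Prop. 2.3 p.238, Lemma 2.4 p.245, Prop. 2.5 p.246, Prop. 2.6 p.247, Prop. 2.7 p.249, Cor. 2.8 p.249 (kernel versions of the lit-balaban lineages, one level, constants theirs)] -/
theorem b6_withB6OfRecord (X : PrintedCarriersR) (Y : PrintedCarriers9X) (Z : PrintedCarriers11) (V : PrintedCarriers14R)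
    (W : PrintedCarriers15) {d L : ℕ} (hd : 2 ≤ d) (hL : Odd L ∧ 1 < L) {a : ℝ} (ha : 0 < a) {δ₀ : ℝ} (hδ : 0 < δ₀)
    {msq : ℝ} (hmsq : 0 ≤ msq) :
    (Upstream.ofPrintedAllXP (withB6OfRecord X d L a δ₀ msq) Y Z V W).b6 :=
  b6BlockParam_oneLevel_famG d L a hd hL ha hδ hmsq

/-- **Consequently the DAG node N03 (`Dag.B6_main` = «b4 → b5 → b6») holds at EVERY binding world whose upstream block is the binding of record
over carriers with this B6 block**, every run `P` — the antecedents are not used (venue form: `YMDAG.N03 w P`).  Bookkeeping over the lineage's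
theorem; whether a ONE-LEVEL block may stand as «the object of record» for N03 is part of the rulings Q-N00-2∕6, not asserted here.
[cite: Balaban1984PropagatorsII, Lemma 2.1 – Cor. 2.8 pp.234–249 (kernel versions of the lit-balaban lineages, one level)] -/
theorem b6_main_withB6OfRecord (X : PrintedCarriersR) (Y : PrintedCarriers9X) (Z : PrintedCarriers11) (V : PrintedCarriers14R)
    (W : PrintedCarriers15) {d L : ℕ} (hd : 2 ≤ d) (hL : Odd L ∧ 1 < L) {a : ℝ} (ha : 0 < a) {δ₀ : ℝ} (hδ : 0 < δ₀)
    {msq : ℝ} (hmsq : 0 ≤ msq) (w : WorldP)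
    (hw : w.up = fun _ => Upstream.ofPrintedAllXP (withB6OfRecord X d L a δ₀ msq) Y Z V W) (P : B12.RunParams) :
    Dag.B6_main (leavesP w P) := by
  intro _ _
  show (w.up P).b6
  rw [hw]
  exact b6_withB6OfRecord X Y Z V W hd hL ha hδ hmsq

end Literature.MathematicalPhysics.QuantumFieldTheory.Balaban1983to89.Node00

end
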